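import Summits.BirchSwinnertonDyer.Rank1Residual.Additive.EmbeddingPlaceFactorisation
import Mathlib.NumberTheory.NumberField.Completion.LiesOverInstances
import HarnessLib

/-!
# T-res (second half), file E: the archimedean places — Galois conjugation on the completions at
# infinite places, `L_w = K_v · L`, and the factorisation of `K`-embeddings (cell `b2b-bsdres`,
# n1011, p17 GEN 4; r2 ROUTE-2 §II.17.7 T-res)

HONEST FRAMING (cell `b2b-bsdres`, verbatim in every file): prove what is provable now; nothing is
booked; no label changes. Infrastructure; ONE definition (the completed conjugation at an infinite
place) + THEOREMS; NO Literature fact; no `sorry`.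

The archimedean twin of files A/B (`AdicCompletionGaloisConj`, `EmbeddingPlaceFactorisation`), on
Mathlib's `NumberField.InfinitePlace.Completion` with the `LiesOver` completion algebra
`NumberField.LiesOver.completionMap : K_v →+* L_w` (`w ∣ v`):

* `liesOver_comap` : `g⁻¹ w = w.comap g` lies over `v` for `g ∈ Gal(L/K)`;
* `infCompletionConj g w : L_{w.comap g} →+* L_w` (the isometry `g` extended to the completions,
  `Isometry.mapRingHom`), `infCompletionConj_coe`, `continuous_infCompletionConj`,
  `infCompletionConj_comp_completionMap`;
* `closure_range_completionMap_union_eq_top` : `L_w` is generated by `K_v` and `L`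
  (dense + finite-dimensional, hence closed, range of `K_v ⊗[K] L → L_w`);
* `exists_infinitePlace_factorisation` : every ring homomorphism `φ : L → Ω`, `Ω` algebraically
  closed, with `φ|_K = ι_v|_K` for `ι_v : K_v → Ω`, is `ε ∘ (L → L_w)` for some `w ∣ v` and
  `ε : L_w → Ω` with `ε ∘ (K_v → L_w) = ι_v`.

References: [NeukirchANT1999] II.§8; [SerreLocalFields1979] II.§3.
-/

noncomputable section

open scoped Classical TensorProduct NumberField.LiesOver

open NumberField NumberField.InfinitePlace Literature.NumberTheory.EllipticCurves

universe u

namespace Summit.BirchSwinnertonDyer.Rank1Residual.Additive.LocalTransport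

variable {K : Type u} [Field K] {L : Type u} [Field L] [Algebra K L]

/-! ## `Gal(L/K)` on infinite places -/

section Conj

variable (g : L ≃ₐ[K] L) (w : InfinitePlace L)

/-- `w.comap g` lies over the same place of `K` as `w` (`g` fixes `K`). [folklore] -/
theorem liesOver_comap (v : InfinitePlace K) [hw : w.1.LiesOver v.1] :
    (w.comap (g : L →+* L)).1.LiesOver v.1 := by
  refine ⟨?_⟩
  ext x
  change w ((g : L →+* L) (algebraMap K L x)) = v x
  rw [RingHom.coe_coe, AlgEquiv.commutes]
  exact comp_of_comap_eq (LiesOver.comap_eq w v) x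

/-- `g` as a ring homomorphism `WithAbs (w ∘ g) → WithAbs w` (Mathlib `WithAbs.map`). [folklore] -/
def conjWithAbs : WithAbs (w.comap (g : L →+* L)).1 →+* WithAbs w.1 :=
  WithAbs.map (w.comap (g : L →+* L)).1 w.1 (g : L →+* L)

/-- `conjWithAbs` is an isometry: `|g x|_w = |x|_{w ∘ g}`. [folklore] -/
theorem isometry_conjWithAbs : Isometry (conjWithAbs g w) :=
  AddMonoidHomClass.isometry_of_norm _ fun x ↦ by
    rw [conjWithAbs, WithAbs.map_apply, WithAbs.norm_toAbs_eq, WithAbs.norm_eq_apply_ofAbs]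
    rfl

/-- **The completed conjugation `ĝ : L_{w ∘ g} →+* L_w`** at an infinite place
(`Isometry.mapRingHom`, transported along `Completion.equiv`). [cite: SerreLocalFields1979, II.§3] -/
def infCompletionConj : (w.comap (g : L →+* L)).Completion →+* w.Completion :=
  ((Completion.equiv w).symm.toRingHom.comp (isometry_conjWithAbs g w).mapRingHom).comp
    (Completion.equiv (w.comap (g : L →+* L))).toRingHom

/-- `ĝ` extends `g`: `ĝ (l : L_{w ∘ g}) = (g l : L_w)`. [cite: SerreLocalFields1979, II.§3] -/
theorem infCompletionConj_coe (l : L) :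
    infCompletionConj g w (algebraMap L (w.comap (g : L →+* L)).Completion l) =
      algebraMap L w.Completion (g l) := by
  apply Completion.ext
  simp only [infCompletionConj, RingHom.coe_comp, RingEquiv.toRingHom_eq_coe, RingHom.coe_coe,
    Function.comp_apply, Completion.equiv_apply, Completion.algebraMap_apply]
  change (Completion.ofCompletion _).toCompletion = _
  rw [Completion.toCompletion_ofCompletion]
  exact (isometry_conjWithAbs g w).mapRingHom_coe (WithAbs.toAbs _ l)

/-- `ĝ` is continuous. [cite: SerreLocalFields1979, II.§3] -/
theorem continuous_infCompletionConj : Continuous (infCompletionConj g w) := by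
  unfold infCompletionConj
  exact (Completion.continuous_ofCompletion w).comp
    (UniformSpace.Completion.continuous_map.comp (Completion.continuous_toCompletion _))

/-- **`ĝ` commutes with `K_v → L_{w ∘ g}`, `K_v → L_w`** (continuous, equal on the dense image of
`K`). [cite: SerreLocalFields1979, II.§3] -/
theorem infCompletionConj_comp_completionMap (v : InfinitePlace K) [w.1.LiesOver v.1] :
    haveI := liesOver_comap g w v
    (infCompletionConj g w).comp (LiesOver.completionMap (v := v) (w := w.comap (g : L →+* L))) =
      LiesOver.completionMap (v := v) (w := w) := by
  haveI := liesOver_comap g w v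
  have key : (infCompletionConj g w ∘ LiesOver.completionMap (v := v) (w := w.comap (g : L →+* L)) :
      v.Completion → w.Completion) = LiesOver.completionMap (v := v) (w := w) := by
    refine (Completion.denseRange_coe (v := v)).equalizer
      ((continuous_infCompletionConj g w).comp LiesOver.continuous_completionMap)
      LiesOver.continuous_completionMap ?_
    funext x
    simp only [Function.comp_apply]
    rw [LiesOver.completionMap_coe, LiesOver.completionMap_coe]
    change infCompletionConj g w (algebraMap L _ (algebraMap K L x.ofAbs)) =
      algebraMap L w.Completion (algebraMap K L x.ofAbs)
    rw [infCompletionConj_coe, AlgEquiv.commutes]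
  exact DFunLike.ext' key

end Conj

/-! ## `L_w` is generated by `K_v` and `L`; factorisation of embeddings -/

section Generation

variable (L) (v : InfinitePlace K) (w : InfinitePlace L) [w.1.LiesOver v.1]

omit [w.1.LiesOver v.1] in
/-- `K → L → L_w` is a scalar tower (the tree's construction in `ShaRestriction`). [folklore] -/
theorem isScalarTower_completion : IsScalarTower K L w.Completion :=
  IsScalarTower.of_algebraMap_eq fun x ↦ by
    apply NumberField.InfinitePlace.Completion.ext
    rw [NumberField.InfinitePlace.Completion.algebraMap_toCompletion,
      NumberField.InfinitePlace.Completion.algebraMap_toCompletion,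
      UniformSpace.Completion.algebraMap_def, UniformSpace.Completion.algebraMap_def,
      IsScalarTower.algebraMap_apply K L (WithAbs w.1)]

/-- **`L_w = K_v[L]`** at an infinite place `w ∣ v`: the subring generated by the images of `K_v`
and `L` is everything (`K_v ⊗[K] L → L_w` has dense and finite-dimensional, hence closed, range).
[cite: NeukirchANT1999, II.§8] -/
theorem closure_range_completionMap_union_eq_top :
    Subring.closure (Set.range (LiesOver.completionMap (v := v) (w := w)) ∪
      Set.range (algebraMap L w.Completion)) = ⊤ := by
  haveI : IsScalarTower K L w.Completion := isScalarTower_completion L w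
  haveI : FiniteDimensional v.Completion w.Completion := (finrank_completion_le_two L v w).1
  letI : NontriviallyNormedField v.Completion :=
    { (inferInstance : NormedField v.Completion) with
      non_trivial := ⟨(WithAbs.toAbs v.1 2 : WithAbs v.1), by
        rw [Completion.norm_coe]
        change (1 : ℝ) < v (2 : K)
        rw [show (2 : K) = ((2 : ℕ) : K) by norm_num, InfinitePlace.map_natCast]
        norm_num⟩ }
  let Φ : v.Completion ⊗[K] L →ₗ[v.Completion] w.Completion :=
    (Algebra.TensorProduct.lift (Algebra.algHom _ _ _) (Algebra.algHom K L _)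
      (fun _ _ ↦ Commute.all _ _)).toLinearMap
  have h_dense : DenseRange Φ := by
    apply ((Completion.denseRange_coe (v := w)).comp (WithAbs.toAbs_surjective w.1).denseRange
      (Completion.continuous_coe (v := w))).mono
    rintro _ ⟨l, rfl⟩
    exact ⟨1 ⊗ₜ l, by simp [Φ, Algebra.algHom]⟩
  have hsurj : Function.Surjective Φ := by
    rw [← Set.range_eq_univ, ← Φ.coe_range, ← Φ.range.closed_of_finiteDimensional.closure_eq]
    exact h_dense.closure_range
  rw [eq_top_iff]
  rintro x -
  obtain ⟨t, rfl⟩ := hsurj x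
  induction t using TensorProduct.induction_on with
  | zero => rw [map_zero]; exact Subring.zero_mem _
  | tmul a l =>
    have hΦ : Φ (a ⊗ₜ l) = LiesOver.completionMap (v := v) (w := w) a * algebraMap L _ l := by
      simp only [Φ, AlgHom.toLinearMap_apply, Algebra.TensorProduct.lift_tmul, Algebra.algHom]
      rfl
    rw [hΦ]
    exact Subring.mul_mem _ (Subring.subset_closure (Or.inl ⟨a, rfl⟩))
      (Subring.subset_closure (Or.inr ⟨l, rfl⟩))
  | add s t hs ht => rw [map_add]; exact Subring.add_mem _ hs ht

/-- **At one infinite place `w ∣ v` there is a `K_v`-embedding `L_w → Ω`** (`L_w/K_v` finite,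
`IsAlgClosed.lift`). [cite: NeukirchANT1999, II.§8] -/
theorem exists_ringHom_infCompletion {Ω : Type u} [Field Ω] [IsAlgClosed Ω]
    (ιv : v.Completion →+* Ω) :
    ∃ ε : w.Completion →+* Ω, ε.comp (LiesOver.completionMap (v := v) (w := w)) = ιv := by
  haveI : FiniteDimensional v.Completion w.Completion := (finrank_completion_le_two L v w).1
  haveI : Algebra.IsAlgebraic v.Completion w.Completion := Algebra.IsAlgebraic.of_finite _ _
  letI : Algebra v.Completion Ω := ιv.toAlgebra
  let ε₀ : w.Completion →ₐ[v.Completion] Ω := IsAlgClosed.lift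
  refine ⟨ε₀.toRingHom, ?_⟩
  ext x
  exact ε₀.commutes x

omit [w.1.LiesOver v.1] in
/-- **Every `K`-embedding `L → Ω` into an algebraically closed field over `K_v` (`v` archimedean)
factors through a completion `L_w`, `w ∣ v`, compatibly with `K_v`** (`L/K` Galois): as in
`exists_place_factorisation`, with `w = w₀.comap g` and the completed conjugation
`infCompletionConj`. [cite: NeukirchANT1999, II.§8] -/
theorem exists_infinitePlace_factorisation [IsGalois K L] {Ω : Type u} [Field Ω] [IsAlgClosed Ω]
    (ιv : v.Completion →+* Ω) (φ : L →+* Ω)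
    (hφ : φ.comp (algebraMap K L) = ιv.comp (algebraMap K v.Completion)) :
    ∃ (w : InfinitePlace L) (_ : w.1.LiesOver v.1) (ε : w.Completion →+* Ω),
      ε.comp (LiesOver.completionMap (v := v) (w := w)) = ιv ∧
        ε.comp (algebraMap L w.Completion) = φ := by
  obtain ⟨w₀, hw₀⟩ := comap_surjective (k := K) (K := L) v
  haveI hlies : w₀.1.LiesOver v.1 := ⟨by
    ext x; rw [← hw₀]; rfl⟩
  obtain ⟨ε₀, hε₀⟩ := exists_ringHom_infCompletion L v w₀ ιv
  letI : Algebra K Ω := (ιv.comp (algebraMap K v.Completion)).toAlgebra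
  have hcoe : ∀ x : K, LiesOver.completionMap (v := v) (w := w₀) (algebraMap K v.Completion x) =
      algebraMap L w₀.Completion (algebraMap K L x) := fun x ↦ by
    haveI : IsScalarTower K L w₀.Completion := isScalarTower_completion L w₀
    rw [← RingHom.algebraMap_toAlgebra (LiesOver.completionMap (v := v) (w := w₀)),
      ← IsScalarTower.algebraMap_apply, ← IsScalarTower.algebraMap_apply]
  have hφ₀K : ∀ x : K, ε₀ (algebraMap L w₀.Completion (algebraMap K L x)) =
      ιv (algebraMap K v.Completion x) := fun x ↦ by
    rw [← hcoe x]
    exact RingHom.congr_fun hε₀ _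
  let φ₀' : L →ₐ[K] Ω :=
    { ε₀.comp (algebraMap L w₀.Completion) with commutes' := fun x ↦ hφ₀K x }
  let φ' : L →ₐ[K] Ω := { φ with commutes' := fun x ↦ RingHom.congr_fun hφ x }
  obtain ⟨g, hg⟩ := exists_algEquiv_eq_comp φ₀' φ'
  have hgl : ∀ l : L, φ l = ε₀ (algebraMap L w₀.Completion (g l)) := fun l ↦
    congrArg (fun f : L →ₐ[K] Ω ↦ f l) hg
  haveI hw : (w₀.comap (g : L →+* L)).1.LiesOver v.1 := liesOver_comap g w₀ v
  refine ⟨w₀.comap (g : L →+* L), hw, ε₀.comp (infCompletionConj g w₀), ?_, ?_⟩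
  · rw [RingHom.comp_assoc]
    have h := infCompletionConj_comp_completionMap g w₀ v
    rw [h, hε₀]
  · ext l
    rw [RingHom.comp_apply, RingHom.comp_apply, hgl l, infCompletionConj_coe]

end Generation

end Summit.BirchSwinnertonDyer.Rank1Residual.Additive.LocalTransport

end
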